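import Mathlib
import HarnessLib
import Summits.NavierStokesRegularity.NavierStokesRegularity.Theorems.ChiralWindowDoorDefs
import Summits.NavierStokesRegularity.NavierStokesRegularity.Theorems.ChiralWindowDoorLambda
import Summits.NavierStokesRegularity.NavierStokesRegularity.Theorems.ChiralWindowDoorFracLapHalfBounds
import Summits.NavierStokesRegularity.NavierStokesRegularity.Theorems.ChiralWindowDoorEssLocalClass
import Summits.NavierStokesRegularity.NavierStokesRegularity.Theorems.ChiralWindowDoorLocalHelicityLower
import Summits.NavierStokesRegularity.NavierStokesRegularity.Theorems.ChiralWindowDoorClassDerivDecay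

/-!
# Door S20 «ChiralWindowDoor» — BINDER-FREE forms of the proved stubs and junk-freeness of `Λ` on door-class
# slices

Door S20 of nsreg-p1's local Type-I door family (`HOME/ns-regularity-ideate-p1/r19/ROUND-19-DRAFT.md`; DESIGN-ONLY,
route NOT born).  R19's texts carry the binder `HasTypeIDerivDecay K v`, which is a THEOREM of the door class
(`…ChiralWindowDoorClassDerivDecay.derivDecay_of_class`, nsreg-p6 g10); should the filed texts drop it, the proved
stubs must still close by `exact`.  This file records:

* `exists_hasTypeIDerivDecay_of_class` — the binder from the class, in the substrate's vocabulary;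
* `localHelicityLower_of_class` — **B1′ without the binder**; `essLocalClass_of_class` — **B5b without the binder**;
* `integrable_fracLapHalf_integrand_of_class`, `continuous_fracLapHalf_of_class` — on every slice of a door-class
  profile the second-difference integral defining `Λ(v s)(x)` CONVERGES ABSOLUTELY and `x ↦ Λ(v s)(x)` is continuous
  (typing-checklist 4c(ii): `IsChiral (v s)`, K1's integrand and K2's window clause carry no Bochner junk in the class).

Seat nsreg-p6 g11 (THEOREMS-ONLY door sequels, DIRECTOR-NS g8 #32 (2)/#36).  WHAT THIS IS NOT: not NS regularity
(Clay A); corollaries of landed theorems; no route is opened.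
-/

noncomputable section

-- the summit and its single sub-problem share the name (CONVENTIONS §1), as in every Theorems file
set_option linter.dupNamespace false

namespace Summit.NavierStokesRegularity.NavierStokesRegularity.Theorems.ChiralWindowDoorBinderFree

open MeasureTheory Set Filter Topology Metric Function
open scoped RealInnerProductSpace
open Literature.Analysis Literature.Analysis.FluidPDE
open Summit.NavierStokesRegularity.NavierStokesRegularity.Theorems.ChiralWindowDoorDefs
open Summit.NavierStokesRegularity.NavierStokesRegularity.Theorems.ChiralWindowDoorLambda
open Summit.NavierStokesRegularity.NavierStokesRegularity.Theorems.ChiralWindowDoorFracLapHalfBounds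
open Summit.NavierStokesRegularity.NavierStokesRegularity.Theorems.ChiralWindowDoorEssLocalClass (essLocalClass)
open Summit.NavierStokesRegularity.NavierStokesRegularity.Theorems.ChiralWindowDoorLocalHelicityLower
open Summit.NavierStokesRegularity.NavierStokesRegularity.Theorems.ChiralWindowDoorClassDerivDecay (derivDecay_of_class)

variable {C D : ℝ} {v : ℝ → EuclideanSpace ℝ (Fin 3) → EuclideanSpace ℝ (Fin 3)}

/-- **The binder from the class** (`derivDecay_of_class`, in the substrate's vocabulary `HasTypeIDerivDecay`). -/
theorem exists_hasTypeIDerivDecay_of_class (hrate : HasTypeITimeDecay C v) (hdecay : HasTypeIDecay D v)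
    (hcont : ContinuousOn (Function.uncurry v) (Set.Iio (0 : ℝ) ×ˢ Set.univ))
    (hmild : ∀ s t : ℝ, s < t → t < 0 → ∀ x,
      v t x = UnboundedOperators.heatExtension (v s) (t - s) x - oseenDuhamel 1 s v v t x)
    (hdiv : ∀ t < 0, VectorCalculus.IsDivFree (v t)) : ∃ K : ℝ, HasTypeIDerivDecay K v :=
  derivDecay_of_class C D v hrate hdecay hcont hmild hdiv

/-- **B1′ without the binder**: for a chiral door-class profile,
`∃ c, ∀ R > 0, ∀ t < 0, gagliardo (bumpSq η R) (v t) ≤ locHelicity (bumpSq η R) (v t) + c`. -/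
theorem localHelicityLower_of_class {η : EuclideanSpace ℝ (Fin 3) → ℝ} (hη : IsAdmissibleBump η)
    (hrate : HasTypeITimeDecay C v) (hdecay : HasTypeIDecay D v)
    (hcont : ContinuousOn (Function.uncurry v) (Set.Iio (0 : ℝ) ×ˢ Set.univ))
    (hmild : ∀ s t : ℝ, s < t → t < 0 → ∀ x,
      v t x = UnboundedOperators.heatExtension (v s) (t - s) x - oseenDuhamel 1 s v v t x)
    (hdiv : ∀ t < 0, VectorCalculus.IsDivFree (v t)) (hchi : ∀ t < 0, IsChiral (v t)) :
    ∃ c : ℝ, ∀ R > (0 : ℝ), ∀ t < (0 : ℝ),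
      gagliardo (bumpSq η R) (v t) ≤ locHelicity (bumpSq η R) (v t) + c := by
  obtain ⟨K, hK⟩ := exists_hasTypeIDerivDecay_of_class hrate hdecay hcont hmild hdiv
  exact localHelicityLower η hη C D K v hrate hdecay hK hcont hmild hdiv hchi

/-- **B5b without the binder**: a door-class profile whose slices are bounded in `L³(B₁)` uniformly on `(−1,0)` is not
backward-singular at the apex. -/
theorem essLocalClass_of_class (hrate : HasTypeITimeDecay C v) (hdecay : HasTypeIDecay D v)
    (hcont : ContinuousOn (Function.uncurry v) (Set.Iio (0 : ℝ) ×ˢ Set.univ))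
    (hmild : ∀ s t : ℝ, s < t → t < 0 → ∀ x,
      v t x = UnboundedOperators.heatExtension (v s) (t - s) x - oseenDuhamel 1 s v v t x)
    (hdiv : ∀ t < 0, VectorCalculus.IsDivFree (v t))
    (hL3 : ∃ M : NNReal, ∀ t ∈ Set.Ioo (-1 : ℝ) 0,
      ∫⁻ x in Metric.ball (0 : EuclideanSpace ℝ (Fin 3)) 1, ‖v t x‖ₑ ^ (3 : ℕ) ≤ M) :
    ¬ IsBackwardSingularPoint v 0 := by
  obtain ⟨K, hK⟩ := exists_hasTypeIDerivDecay_of_class hrate hdecay hcont hmild hdiv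
  exact essLocalClass C D K v hrate hdecay hK hcont hmild hdiv hL3

/-- **`Λ` is junk-free on door-class slices**: for every `s < 0` and every `x`, the second-difference integrand of
`fracLapHalf (v s) x` is Bochner-integrable on `ℝ³` (slice `C²`, bounded by the Type-I rate, bounded second
derivative by the binder-from-the-class). -/
theorem integrable_fracLapHalf_integrand_of_class (hrate : HasTypeITimeDecay C v) (hdecay : HasTypeIDecay D v)
    (hcont : ContinuousOn (Function.uncurry v) (Set.Iio (0 : ℝ) ×ˢ Set.univ))
    (hmild : ∀ s t : ℝ, s < t → t < 0 → ∀ x,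
      v t x = UnboundedOperators.heatExtension (v s) (t - s) x - oseenDuhamel 1 s v v t x)
    (hdiv : ∀ t < 0, VectorCalculus.IsDivFree (v t)) {s : ℝ} (hs : s < 0) (x : EuclideanSpace ℝ (Fin 3)) :
    Integrable (fun z => lamK z • ((2 : ℝ) • v s x - v s (x + z) - v s (x - z))) := by
  obtain ⟨K, hK⟩ := exists_hasTypeIDerivDecay_of_class hrate hdecay hcont hmild hdiv
  obtain ⟨_, hfc, hf0, _, hf2⟩ := slice_regularity hrate hK hcont hmild hs
  exact integrable_fracLapHalf_integrand hfc hf0 hf2 x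

/-- **`x ↦ Λ(v s)(x)` is continuous** on every slice of a door-class profile. -/
theorem continuous_fracLapHalf_of_class (hrate : HasTypeITimeDecay C v) (hdecay : HasTypeIDecay D v)
    (hcont : ContinuousOn (Function.uncurry v) (Set.Iio (0 : ℝ) ×ˢ Set.univ))
    (hmild : ∀ s t : ℝ, s < t → t < 0 → ∀ x,
      v t x = UnboundedOperators.heatExtension (v s) (t - s) x - oseenDuhamel 1 s v v t x)
    (hdiv : ∀ t < 0, VectorCalculus.IsDivFree (v t)) {s : ℝ} (hs : s < 0) :
    Continuous (fracLapHalf (v s)) := by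
  obtain ⟨K, hK⟩ := exists_hasTypeIDerivDecay_of_class hrate hdecay hcont hmild hdiv
  obtain ⟨_, hfc, hf0, _, hf2⟩ := slice_regularity hrate hK hcont hmild hs
  have h := continuous_secondDiffOp hfc hf0 hf2 0
  rw [lamKTrunc_zero] at h
  set g : EuclideanSpace ℝ (Fin 3) → EuclideanSpace ℝ (Fin 3) := fun x =>
    ∫ z, lamK z • ((2 : ℝ) • v s x - v s (x + z) - v s (x - z)) with hg
  have hgc : Continuous g := h
  have hc : Continuous fun x => (1 / 2 : ℝ) • g x := by fun_prop
  exact hc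

end Summit.NavierStokesRegularity.NavierStokesRegularity.Theorems.ChiralWindowDoorBinderFree
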